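import Literature.NumberTheory.IwasawaTheory.ClassGroupCoinvariantGenusCriterion
import Literature.NumberTheory.IwasawaTheory.ZpExtensionLayerRamifiedPrimesBound
import Literature.NumberTheory.NumberFields.QuadraticGenusTwoRankBound
import Summits.BirchSwinnertonDyer.BirchSwinnertonDyer.Theorems.ByReductionTypeAtTwoAdditivePotGoodLowerHalfT0SmallRankRowsD
import Summits.BirchSwinnertonDyer.BirchSwinnertonDyer.Theorems.ByReductionTypeAtTwoFineSelmerConjAAtTwoAdditivePotGoodClassNumberOned28712n
import Summits.BirchSwinnertonDyer.BirchSwinnertonDyer.Theorems.ByReductionTypeAtTwoFineSelmerConjAAtTwoAdditivePotGoodCapitulationDoorTwoPrimes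
import HarnessLib

/-!
# K4 crux `AdditiveRankZeroAtTwo` (19098), child C3″ `AdditivePotGoodLowerHalfAtTwo` (item 22617): row `315832c1` — (A)₂ and the BSD₂ rungs from
# ONE displayed statement in the SEXTIC layer: «some unit of `K₁ = ℚ(θ)·ℚ₁` is not a norm from `K₂`» (the COINVARIANT-GENUS road; everything else KERNEL)
# (seat `bsd-2adic-k4-w2` GEN 14; `--supports stmt-BirchSwinnertonDyer-22617 --as helper`)

Cell `bsd-2adic`.  The open-type row `315832c1` (`Δ_cubic < 0`, point field `ℚ(θ)`, `θ³ − θ² − 24θ + 88 = 0`, `d = −28712`, `2 = 𝔭²𝔮`, tower ranks `0/1/1`) was so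
far valued by ONE instrument inequality on the degree-`12` layer (`AddKatoTwo.conjA_two_315832c1_of_rankLe₂`: `rank₂ Cl(ℚ(θ)·ℚ₂) ≤ 2`, PARI/GRH).  The genus
road of this GEN (`IwasawaTheory.classicalMuVanishes_of_rank_add_le_layer_succ_succ`: `TotallyRamifiedFrom κ 0 ∧ rank₂ Cl(K₁) + t ≤ 2 + r ⟹ μ₂ = 0`) is fed here
with KERNEL inputs for everything but `r`:
* `n₀ = 0`: `forall_totallyRamifiedFrom_zero_h315832c1` (GEN 11);
* `rank₂ Cl(K₁) ≤ 1`: `h(ℚ(θ)) = 1` (`classNumber_eq_one_of_root_d28712n`, this GEN) + `AmbiguousClass.index_pow_two_mul_le_pow_of_odd_classNumber`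
  (`QuadraticGenusTwoRankBound.lean`: `[Cl(K₁):Cl(K₁)²]·2·[E:E∩N] ≤ 2^{t₀}`) + `t₀ ≤ #{w ∋ 2} ≤ 2` (primes of `ℚ(θ)` ramified in `K₁` lie over `2`;
  `ncard_primes_above_two_le_two` with the odd-index generator `b2`);
* `t ≤ 2`: `ncard_ramified_layer_succ_le_ncard_primes_above` (`ZpExtensionLayerRamifiedPrimesBound.lean`, this GEN) + the same count;
* `r ≥ 1` ⟸ THE DISPLAYED HYPOTHESIS `hunit` (through k4-w1's `two_dvd_relIndex_of_nonNorm`).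

* §1 `AddKatoTwo.classGroupNorm_layer_one_surjective_h315832c1`-free plumbing (private) and ★ `AddKatoTwo.conjA_two_315832c1_of_layerOneNonNormUnit hθ hunit`.
* §2 the C3″ rungs `AddPotGoodInstances.conjA_two_315832c1_of_layerOneNonNormUnit_kernelLit`, `bsdp_two_315832c1_layerOneNonNormUnit`,
  `bsdp_two_of_isIsogenous_315832c1_layerOneNonNormUnit`.

THE CERTIFICATE BEHIND `hunit` (exact arithmetic of this seat, memo `k4w2/gen14/CERT-315832c1-COINVGENUS-k4w2-GEN14.md`; NOT yet kernel): with `π_𝔭 = (16 − 7θ + θ²)/2`,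
`ξ = √2/π_𝔭` (`ξ² = π_𝔮 = θ² − 2θ − 45`, `𝓞_{K₁} = 𝓞_{ℚ(θ)} ⊕ 𝓞_{ℚ(θ)}·(1+ξ)/π_𝔭`), the unit
`η′ = (54448 − 83987θ − 16153θ²)/4 + ((−86448 + 1813θ + 2899θ²)/4)·ξ` has `N_{K₁/K₀}(η′) = ε₀⁻¹ = −1605489159 + 453213245θ + 126394531θ²`, `ε₀ ≡ 9 (mod 16)` at the
`e1f1` dyadic place, hence `η′ ∉ N(K₂ˣ)` (CFT-free: `η′·(1 − (2+√2)ξ²) ≡ 1 + ξ⁴ (mod ξ⁵)` and k4-w1's `not_exists_sq_sub_mul_sq_fractionRing_of_pow_four_dvd`).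

HONEST FRAMING (D-0036 / D-0054 / D-0152): conditional theorems; `hunit` is DISPLAYED (its discharge is sextic arithmetic in the style of the cell's
`…NarrowRankCertificate316LayerOne*` files).  Closes nothing at the `∀`-level (C3″ 22617 / C1″ 22615 OPEN); nothing booked; no rung moves; BSD is not proved by any
of this.  THEOREMS ONLY (no `def`).

References: [Washington1997] §13.1 Prop. 13.2, §13.3 Lemma 13.18, Prop. 13.22–13.23; [Fukuda1994] Thm. 1 (2), p. 264; [Lang1990] Ch. 13 §4 Lemma 4.1; [Gras2003] IV.4;
[CoatesSujatha2005] (A), Thm. 3.4; [Kato2004Asterisque] Thm. 12.5 (1)(3), 13.8, 14.14; [Cassels1965ArithmeticVIII] Thm. 1.3; [Miller2011LMS] Def. 1.1.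
-/

set_option autoImplicit false
-- the Theorems namespace of this sub repeats the summit name by design (D-0017 nested layout)
set_option linter.dupNamespace false

noncomputable section

open scoped Classical IntermediateField NumberField Real nonZeroDivisors

/-! ## §1 The layer-one non-norm-unit stamp (namespace `AddKatoTwo`) -/

namespace Summit.BirchSwinnertonDyer.BirchSwinnertonDyer.Theorems.AddKatoTwo

open WeierstrassCurve Field Polynomial IsDedekindDomain NumberField Matrix Literature.NumberTheory.EllipticCurves
  Literature.NumberTheory.GaloisRepresentations Literature.NumberTheory.GaloisRepresentations.Herbrand
  Literature.NumberTheory.GaloisRepresentations.MinkowskiUnit Literature.NumberTheory.GaloisRepresentations.CyclicNormIndex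
  Literature.NumberTheory.NumberFields Literature.NumberTheory.NumberFields.AmbiguousClass
  Literature.NumberTheory.IwasawaTheory
  Summit.BirchSwinnertonDyer.BirchSwinnertonDyer.Theorems.SteinbergFibreAtTwo
  Summit.BirchSwinnertonDyer.BirchSwinnertonDyer.Theorems.AlignedTransportAtTwoTorsionPointField
  Summit.BirchSwinnertonDyer.BirchSwinnertonDyer.Theses.ByReductionTypeAtTwo

/-- **`N : Cl(K_m) → Cl(K)` is onto for `m ≥ 1` when the Fukuda index is `0`**: a prime of `K_m` is totally ramified over `K` (its inertia group in
`Gal(K_m/K)` contains every automorphism, `ZpExtension.exists_isMaximal_forall_mem_inertia` at index `0`; `#I = e`), and a totally ramified prime makes the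
norm onto (`classGroupNorm_surjective_of_ramificationIdx_eq_finrank`). [cite: Washington1997, §13.1 Lemma 13.3 and Thm. 10.1] -/
private theorem classGroupNorm_layer_surjective_of_totallyRamifiedFrom_zero {F : Type} [Field F] [NumberField F]
    (κ : ZpExtension F 2) (hκ : TotallyRamifiedFrom κ 0) (m : ℕ) (hm : 0 < m) [NumberField (κ.layer m)] :
    Function.Surjective (classGroupNorm F (κ.layer m)) := by
  classical
  haveI : Fact (Nat.Prime 2) := ⟨Nat.prime_two⟩
  haveI : FiniteDimensional F (κ.layer m) := κ.finiteDimensional_layer_holds _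
  haveI : IsGalois F (κ.layer m) := κ.isGalois_layer_holds _
  obtain ⟨Q, hQmax, hQ⟩ := κ.exists_isMaximal_forall_mem_inertia hκ (n := 0) (m := m) le_rfl (Nat.zero_le _) hm
  haveI := hQmax
  have htop : Q.inertia ((κ.layer m) ≃ₐ[F] (κ.layer m)) = ⊤ := by
    refine top_le_iff.mp fun g _ => hQ g fun x hx => ?_
    rw [κ.layer_zero, IntermediateField.mem_bot] at hx
    obtain ⟨k, hk⟩ := hx
    have hx' : x = algebraMap F (κ.layer m) k := Subtype.ext hk.symm
    rw [hx', AlgEquiv.commutes]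
  haveI : (Q.under (𝓞 F)).IsMaximal := Ideal.IsMaximal.under (𝓞 F) Q
  have hcard := Ideal.card_inertia_eq_ramificationIdxIn (G := (κ.layer m) ≃ₐ[F] (κ.layer m)) (Q.under (𝓞 F)) Q
  rw [htop, Subgroup.card_top, Nat.card_eq_fintype_card, ← Nat.card_eq_fintype_card, IsGalois.card_aut_eq_finrank,
    Ideal.ramificationIdxIn_eq_ramificationIdx (Q.under (𝓞 F)) Q ((κ.layer m) ≃ₐ[F] (κ.layer m))] at hcard
  exact classGroupNorm_surjective_of_ramificationIdx_eq_finrank F (κ.layer m) Q hcard.symm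

/-- **The primes of `K` ramified in a layer `K_m` contain `p = 2`** (a `ℤ₂`-extension is unramified outside `2`, Washington Prop. 13.2,
`isUnramifiedAt_layer_of_natCast_not_mem_under`), so their number is at most `#{w ∋ 2}`. [cite: Washington1997, §13.1 Prop. 13.2] -/
private theorem ncard_ramified_layer_le_ncard_primes_above {F : Type} [Field F] [NumberField F]
    (κ : ZpExtension F 2) (m : ℕ) [NumberField (κ.layer m)] :
    {v : HeightOneSpectrum (𝓞 F) | v.asIdeal.ramificationIdxIn (𝓞 (κ.layer m)) ≠ 1}.ncard ≤
      {w : HeightOneSpectrum (𝓞 F) | ((2 : ℕ) : 𝓞 F) ∈ w.asIdeal}.ncard := by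
  classical
  haveI : Fact (Nat.Prime 2) := ⟨Nat.prime_two⟩
  haveI : FiniteDimensional F (κ.layer m) := κ.finiteDimensional_layer_holds _
  haveI : IsGalois F (κ.layer m) := κ.isGalois_layer_holds _
  have hp0 : (Ideal.span {((2 : ℕ) : 𝓞 F)} : Ideal (𝓞 F)) ≠ ⊥ := by
    rw [Ne, Ideal.span_singleton_eq_bot]; norm_num
  have hTfin : {w : HeightOneSpectrum (𝓞 F) | ((2 : ℕ) : 𝓞 F) ∈ w.asIdeal}.Finite := by
    refine (Ideal.finite_factors hp0).subset fun w hw => ?_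
    exact (Ideal.dvd_span_singleton).mpr hw
  refine Set.ncard_le_ncard (fun v hv => ?_) hTfin
  haveI : v.asIdeal.IsMaximal := v.isMaximal
  obtain ⟨Q, hQmax, hQv⟩ := Ideal.exists_maximal_ideal_liesOver_of_isIntegral (S := 𝓞 (κ.layer m)) v.asIdeal
  haveI := hQmax; haveI := hQv
  have he : Q.ramificationIdx (𝓞 F) ≠ 1 := by
    have hv' : v.asIdeal.ramificationIdxIn (𝓞 (κ.layer m)) ≠ 1 := hv
    rwa [Ideal.ramificationIdxIn_eq_ramificationIdx v.asIdeal Q ((κ.layer m) ≃ₐ[F] (κ.layer m))] at hv'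
  by_contra hnot
  have hnot' : ((2 : ℕ) : 𝓞 F) ∉ Q.under (𝓞 F) := by rwa [← hQv.over]
  haveI := κ.isUnramifiedAt_layer_of_natCast_not_mem_under m Q hnot'
  exact he (Ideal.ramificationIdx_eq_one_of_isUnramifiedAt (R := 𝓞 F) (p := Q))

set_option maxHeartbeats 800000 in
set_option synthInstance.maxHeartbeats 200000 in
/-- ★ **(A)₂ for `315832c1` from ONE displayed sextic statement: a unit of `K₁` outside `N(K₂ˣ)`** (open-type row of the C1″ census: `d = −28712`, `2 = 𝔭²𝔮`,
`h = 1`; tower ranks 0 / 1 / 1).  For every cyclotomic `ℤ₂`-extension of `ℚ(θ)` (`θ` any root of `X³ + (-1)X² + (-24)X + (88)`, `ℚ(P) = ℚ(θ)`) with layers `K₁ ⊆ K₂`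
(inclusion algebra structure), ASSUME **some `u ∈ E_{K₁}` (inside `K₂ˣ`) is not in `E_{K₂} ∩ N_{Gal(K₂/K₁)} K₂ˣ`**.  KERNEL: `n₀ = 0`; `h(ℚ(θ)) = 1` ⟹ `rank₂ Cl(K₁) ≤ 1` (genus
bound with odd base class number, two primes above `2`); `t ≤ 2` (ramified primes of `K₂/K₁` inject into the primes of `ℚ(θ)` above `2`); `r ≥ 1` from `hunit`;
`1 + 2 ≤ 1 + 1 + 1` ⟹ `μ₂(ℚ(θ)_cyc) = 0` (`classicalMuVanishes_of_rank_add_le_layer_succ_succ`) ⟹ (A)₂ by the μ-interface `conjA_two_315832c1_of_classicalMu`.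
No degree-`12` class group, no `hLim2`, no Fukuda fact.  BSD for `315832c1` is NOT proved by this.  [cite: Washington1997, §13.3 Prop. 13.22–13.23]
[cite: Lang1990, Ch. 13 §4, Lemma 4.1] [cite: Gras2003, IV.4] [cite: CoatesSujatha2005, Conj. A and Thm. 3.4] -/
theorem conjA_two_315832c1_of_layerOneNonNormUnit
    {θ : AlgebraicClosure ℚ} (hθ : aeval θ (Cubic.toPoly ⟨1, ((-1 : ℤ) : ℚ), ((-24 : ℤ) : ℚ), ((88 : ℤ) : ℚ)⟩) = 0)
    (hunit : haveI : FiniteDimensional ℚ (IntermediateField.adjoin ℚ {θ}) :=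
        IntermediateField.adjoin.finiteDimensional ((AlgebraicClosure.isAlgebraic ℚ).isAlgebraic θ).isIntegral
      haveI : NumberField (IntermediateField.adjoin ℚ {θ}) := NumberField.mk
      ∀ κL : ZpExtension (IntermediateField.adjoin ℚ {θ}) 2, κL.IsCyclotomic →
        haveI : FiniteDimensional (IntermediateField.adjoin ℚ {θ}) (κL.layer (0 + 1)) := κL.finiteDimensional_layer_holds _
        haveI : FiniteDimensional (IntermediateField.adjoin ℚ {θ}) (κL.layer (0 + (1 + 1))) := κL.finiteDimensional_layer_holds _
        haveI : NumberField (κL.layer (0 + 1)) := NumberField.of_module_finite (IntermediateField.adjoin ℚ {θ}) (κL.layer (0 + 1))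
        haveI : NumberField (κL.layer (0 + (1 + 1))) := NumberField.of_module_finite (IntermediateField.adjoin ℚ {θ}) (κL.layer (0 + (1 + 1)))
        letI : Algebra (κL.layer (0 + 1)) (κL.layer (0 + (1 + 1))) := (IntermediateField.inclusion (κL.layer_mono (by omega))).toRingHom.toAlgebra
        ∃ u : ((κL.layer (0 + (1 + 1))))ˣ, u ∈ unitsE (κL.layer (0 + (1 + 1))) ⊓ (unitsIncl (κL.layer (0 + 1)) (κL.layer (0 + (1 + 1)))).range ∧
          u ∉ unitsE (κL.layer (0 + (1 + 1))) ⊓ (⊤ : Subgroup ((κL.layer (0 + (1 + 1))))ˣ).map (Herbrand.norm ((κL.layer (0 + (1 + 1))) ≃ₐ[(κL.layer (0 + 1))] (κL.layer (0 + (1 + 1))))))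
    (κ : ZpExtension ℚ 2) (hκ : κ.IsCyclotomic) :
    haveI := (isElliptic_cubicModel _ _ _ (by simp only [Cubic.discr]; norm_num) : (⟨0, ((0 : ℤ) : ℚ), 0, ((79574117 : ℤ) : ℚ), ((176712113750 : ℤ) : ℚ)⟩ : WeierstrassCurve ℚ).IsElliptic)
    ∃ (γ : absoluteGaloisGroup ℚ) (D : (⟨0, ((0 : ℤ) : ℚ), 0, ((79574117 : ℤ) : ℚ), ((176712113750 : ℤ) : ℚ)⟩ : WeierstrassCurve ℚ).FineSelmerDualData κ γ),
      Module.Finite ℤ_[2] (RestrictScalars ℤ_[2] (IwasawaAlgebra 2) D.X) := by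
  classical
  haveI : FiniteDimensional ℚ (IntermediateField.adjoin ℚ {θ}) :=
    IntermediateField.adjoin.finiteDimensional ((AlgebraicClosure.isAlgebraic ℚ).isAlgebraic θ).isIntegral
  haveI : NumberField (IntermediateField.adjoin ℚ {θ}) := NumberField.mk
  haveI : Fact (Nat.Prime 2) := ⟨Nat.prime_two⟩
  -- the cubic field: degree 3, an integral root `B`, the odd-index generator `b2`, `h = 1`, at most two primes above `2`
  have h3 := finrank_adjoin_eq_three_of_irreducible irreducible_cubic_h315832c1 hθ
  obtain ⟨B, -, hB⟩ := exists_ringOfIntegers_cubic_root (p := -1) (q := -24) (r := 88) hθ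
  have hh1 : NumberField.classNumber (IntermediateField.adjoin ℚ {θ}) = 1 := classNumber_eq_one_of_root_d28712n (IntermediateField.adjoin ℚ {θ}) h3 B hB
  have hodd : Odd (NumberField.classNumber (IntermediateField.adjoin ℚ {θ})) := by rw [hh1]; exact odd_one
  obtain ⟨b2, -, hb2⟩ := exists_intElem_of_scaled_cubic (IntermediateField.adjoin ℚ {θ}) B (-2) 3 (-1) (m := 2) (by norm_num) 26 3 352
    (by push_cast; linear_combination (((34 : ℤ) : 𝓞 (IntermediateField.adjoin ℚ {θ})) + ((3 : ℤ) : 𝓞 (IntermediateField.adjoin ℚ {θ})) * B + ((8 : ℤ) : 𝓞 (IntermediateField.adjoin ℚ {θ})) * B ^ 2 + ((-1 : ℤ) : 𝓞 (IntermediateField.adjoin ℚ {θ})) * B ^ 3) * hB)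
  have htwo : {w : HeightOneSpectrum (𝓞 (IntermediateField.adjoin ℚ {θ})) | ((2 : ℕ) : 𝓞 (IntermediateField.adjoin ℚ {θ})) ∈ w.asIdeal}.ncard ≤ 2 :=
    ncard_primes_above_two_le_two (IntermediateField.adjoin ℚ {θ}) h3 b2 irreducible_cubic_d28712n_aux2 hb2 ⟨1, by norm_num⟩ ⟨0, by norm_num⟩
  refine conjA_two_315832c1_of_classicalMu hθ (fun κL hκL => ?_) κ hκ
  have hκ0 := forall_totallyRamifiedFrom_zero_h315832c1 hθ κL hκL
  haveI : FiniteDimensional (IntermediateField.adjoin ℚ {θ}) (κL.layer (0 + 1)) := κL.finiteDimensional_layer_holds _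
  haveI : FiniteDimensional (IntermediateField.adjoin ℚ {θ}) (κL.layer (0 + (1 + 1))) := κL.finiteDimensional_layer_holds _
  haveI : NumberField (κL.layer (0 + 1)) := NumberField.of_module_finite (IntermediateField.adjoin ℚ {θ}) (κL.layer (0 + 1))
  haveI : NumberField (κL.layer (0 + (1 + 1))) := NumberField.of_module_finite (IntermediateField.adjoin ℚ {θ}) (κL.layer (0 + (1 + 1)))
  haveI : IsGalois (IntermediateField.adjoin ℚ {θ}) (κL.layer (0 + 1)) := κL.isGalois_layer_holds _
  haveI : IsUnramifiedAtInfinitePlaces (IntermediateField.adjoin ℚ {θ}) (κL.layer (0 + 1)) := κL.isUnramifiedAtInfinitePlaces_layer _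
  have hML : κL.layer (0 + 1) ≤ κL.layer (0 + (1 + 1)) := κL.layer_mono (by omega)
  letI : Algebra (κL.layer (0 + 1)) (κL.layer (0 + (1 + 1))) := (IntermediateField.inclusion hML).toRingHom.toAlgebra
  haveI : IsScalarTower (IntermediateField.adjoin ℚ {θ}) (κL.layer (0 + 1)) (κL.layer (0 + (1 + 1))) := IsScalarTower.of_algebraMap_eq fun x => ((IntermediateField.inclusion hML).commutes x).symm
  haveI : FiniteDimensional (κL.layer (0 + 1)) (κL.layer (0 + (1 + 1))) := Module.Finite.of_restrictScalars_finite (IntermediateField.adjoin ℚ {θ}) (κL.layer (0 + 1)) (κL.layer (0 + (1 + 1)))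
  haveI : IsGalois (κL.layer (0 + 1)) (κL.layer (0 + (1 + 1))) := isGalois_layer_layer κL
  -- `k = 1`: `[Cl(K₁) : Cl(K₁)²] ≤ 2`
  have hdeg₁ : Module.finrank (IntermediateField.adjoin ℚ {θ}) (κL.layer (0 + 1)) = 2 := by rw [κL.finrank_layer_holds (0 + 1)]; norm_num
  have hN₁ := classGroupNorm_layer_surjective_of_totallyRamifiedFrom_zero κL hκ0 (0 + 1) (by norm_num)
  have hgen₁ := index_pow_two_mul_le_pow_of_odd_classNumber (K := (IntermediateField.adjoin ℚ {θ})) (L := (κL.layer (0 + 1))) hdeg₁ hodd hN₁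
  have ht₀ := (ncard_ramified_layer_le_ncard_primes_above κL (0 + 1)).trans htwo
  have hU₁ : 0 < (unitsE (κL.layer (0 + 1)) ⊓ (⊤ : Subgroup ((κL.layer (0 + 1)))ˣ).map (Herbrand.norm ((κL.layer (0 + 1)) ≃ₐ[(IntermediateField.adjoin ℚ {θ})] (κL.layer (0 + 1))))).relIndex
      (unitsE (κL.layer (0 + 1)) ⊓ (unitsIncl (IntermediateField.adjoin ℚ {θ}) (κL.layer (0 + 1))).range) := by
    haveI : IsCyclic ((κL.layer (0 + 1)) ≃ₐ[(IntermediateField.adjoin ℚ {θ})] (κL.layer (0 + 1))) :=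
      isCyclic_of_prime_card (p := 2) (by rw [IsGalois.card_aut_eq_finrank, hdeg₁])
    obtain ⟨σ, hσ⟩ := IsCyclic.exists_generator (α := (κL.layer (0 + 1)) ≃ₐ[(IntermediateField.adjoin ℚ {θ})] (κL.layer (0 + 1)))
    exact Nat.pos_of_ne_zero (relIndex_unitsNorm_ne_zero hσ).1
  have hk : (powMonoidHom 2 : ClassGroup (𝓞 (κL.layer (0 + 1))) →* ClassGroup (𝓞 (κL.layer (0 + 1)))).range.index ≤ 2 ^ 1 := by
    set X := (powMonoidHom 2 : ClassGroup (𝓞 (κL.layer (0 + 1))) →* ClassGroup (𝓞 (κL.layer (0 + 1)))).range.index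
    set U := (unitsE (κL.layer (0 + 1)) ⊓ (⊤ : Subgroup ((κL.layer (0 + 1)))ˣ).map (Herbrand.norm ((κL.layer (0 + 1)) ≃ₐ[(IntermediateField.adjoin ℚ {θ})] (κL.layer (0 + 1))))).relIndex
      (unitsE (κL.layer (0 + 1)) ⊓ (unitsIncl (IntermediateField.adjoin ℚ {θ}) (κL.layer (0 + 1))).range)
    have h4 : X * 2 * U ≤ 2 ^ 2 :=
      hgen₁.trans (Nat.pow_le_pow_right (by norm_num) ht₀)
    have h5 : X * 2 ≤ 4 := by
      have : X * 2 * 1 ≤ X * 2 * U := Nat.mul_le_mul_left _ hU₁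
      omega
    rw [pow_one]; omega
  -- `r = 1` from the displayed unit
  have hdeg : Module.finrank (κL.layer (0 + 1)) (κL.layer (0 + (1 + 1))) = 2 := by
    rw [finrank_layer_layer κL (show 0 + 1 ≤ 0 + (1 + 1) by omega)]; norm_num
  obtain ⟨u, hu, hnot⟩ := hunit κL hκL
  have hr : 2 ^ 1 ∣ (unitsE (κL.layer (0 + (1 + 1))) ⊓ (⊤ : Subgroup ((κL.layer (0 + (1 + 1))))ˣ).map (Herbrand.norm ((κL.layer (0 + (1 + 1))) ≃ₐ[(κL.layer (0 + 1))] (κL.layer (0 + (1 + 1)))))).relIndex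
      (unitsE (κL.layer (0 + (1 + 1))) ⊓ (unitsIncl (κL.layer (0 + 1)) (κL.layer (0 + (1 + 1)))).range) := by
    rw [pow_one]; exact two_dvd_relIndex_of_nonNorm hdeg hu hnot
  -- `t ≤ 2` (the bound is stated for the pair `(K_{0+1}, K_{0+1+1})`; the layers `K_{0+1+1}` and `K_{0+(1+1)}` agree definitionally)
  have ht2 : {v : HeightOneSpectrum (𝓞 (κL.layer (0 + 1))) | v.asIdeal.ramificationIdxIn (𝓞 (κL.layer (0 + (1 + 1)))) ≠ 1}.ncard ≤ 2 := by
    have := (ncard_ramified_layer_succ_le_ncard_primes_above κL hκ0 (0 + 1)).trans htwo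
    exact this
  have ht : 1 + {v : HeightOneSpectrum (𝓞 (κL.layer (0 + 1))) | v.asIdeal.ramificationIdxIn (𝓞 (κL.layer (0 + (1 + 1)))) ≠ 1}.ncard ≤ 1 + 1 + 1 := by
    omega
  exact (classicalMuVanishes_of_rank_add_le_layer_succ_succ κL hκ0 (c := 1) (k := 1) (r := 1) (by norm_num) hk hr ht).2

end Summit.BirchSwinnertonDyer.BirchSwinnertonDyer.Theorems.AddKatoTwo

/-! ## §2 The C3″ rungs (namespace `AddPotGoodInstances`) -/

namespace Summit.BirchSwinnertonDyer.BirchSwinnertonDyer.Theorems.AddPotGoodInstances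

open WeierstrassCurve Polynomial Literature.NumberTheory.EllipticCurves
  Literature.NumberTheory.GaloisRepresentations Literature.NumberTheory.GaloisRepresentations.Herbrand
  Literature.NumberTheory.GaloisRepresentations.MinkowskiUnit Literature.NumberTheory.GaloisRepresentations.CyclicNormIndex
  Literature.NumberTheory.IwasawaTheory IsDedekindDomain NumberField
  Literature.NumberTheory.EllipticCurves.Rank1Residual
  Literature.NumberTheory.EllipticCurves.Rank1Residual.Typed
  Summit.BirchSwinnertonDyer.Rank1Residual
  Summit.BirchSwinnertonDyer.Rank1Residual.Additive
  Summit.BirchSwinnertonDyer.BirchSwinnertonDyer.Theorems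

/-- Model transport for (A) at `2` in the `∃ γ D` spelling (the statement only depends on the Weierstrass CURVE).
[cite: CoatesSujatha2005, statement (A)] -/
private theorem conjA_two_of_eq_g14 {W W' : WeierstrassCurve ℚ} (h : W' = W)
    (H : ∀ (κ : ZpExtension ℚ 2), κ.IsCyclotomic →
      ∃ (γ : Field.absoluteGaloisGroup ℚ) (D : W'.FineSelmerDualData κ γ), Module.Finite ℤ_[2] (RestrictScalars ℤ_[2] (IwasawaAlgebra 2) D.X)) :
    ∀ (κ : ZpExtension ℚ 2), κ.IsCyclotomic →
      ∃ (γ : Field.absoluteGaloisGroup ℚ) (D : W.FineSelmerDualData κ γ), Module.Finite ℤ_[2] (RestrictScalars ℤ_[2] (IwasawaAlgebra 2) D.X) := by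
  subst h; exact H

/-! ## Row `315832c1` (Δ_cubic < 0, open type; stamp `AddKatoTwo.conjA_two_315832c1_of_layerOneNonNormUnit` of §1) -/

/-- **(A) at `(315832c1, 2)` for the Cremona model from ONE displayed sextic statement (a non-norm unit), NO print fact**: §1's
`AddKatoTwo.conjA_two_315832c1_of_layerOneNonNormUnit` transported from its cast model to the literal model. [cite: CoatesSujatha2005, statement (A)] -/
theorem conjA_two_315832c1_of_layerOneNonNormUnit_kernelLit
    {θ : AlgebraicClosure ℚ} (hθ : aeval θ (Cubic.toPoly ⟨1, ((-1 : ℤ) : ℚ), ((-24 : ℤ) : ℚ), ((88 : ℤ) : ℚ)⟩) = 0)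
    (hunit : haveI : FiniteDimensional ℚ (IntermediateField.adjoin ℚ {θ}) :=
        IntermediateField.adjoin.finiteDimensional ((AlgebraicClosure.isAlgebraic ℚ).isAlgebraic θ).isIntegral
      haveI : NumberField (IntermediateField.adjoin ℚ {θ}) := NumberField.mk
      ∀ κL : ZpExtension (IntermediateField.adjoin ℚ {θ}) 2, κL.IsCyclotomic →
        haveI : FiniteDimensional (IntermediateField.adjoin ℚ {θ}) (κL.layer (0 + 1)) := κL.finiteDimensional_layer_holds _
        haveI : FiniteDimensional (IntermediateField.adjoin ℚ {θ}) (κL.layer (0 + (1 + 1))) := κL.finiteDimensional_layer_holds _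
        haveI : NumberField (κL.layer (0 + 1)) := NumberField.of_module_finite (IntermediateField.adjoin ℚ {θ}) (κL.layer (0 + 1))
        haveI : NumberField (κL.layer (0 + (1 + 1))) := NumberField.of_module_finite (IntermediateField.adjoin ℚ {θ}) (κL.layer (0 + (1 + 1)))
        letI : Algebra (κL.layer (0 + 1)) (κL.layer (0 + (1 + 1))) := (IntermediateField.inclusion (κL.layer_mono (by omega))).toRingHom.toAlgebra
        ∃ u : ((κL.layer (0 + (1 + 1))))ˣ, u ∈ unitsE (κL.layer (0 + (1 + 1))) ⊓ (unitsIncl (κL.layer (0 + 1)) (κL.layer (0 + (1 + 1)))).range ∧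
          u ∉ unitsE (κL.layer (0 + (1 + 1))) ⊓ (⊤ : Subgroup ((κL.layer (0 + (1 + 1))))ˣ).map (Herbrand.norm ((κL.layer (0 + (1 + 1))) ≃ₐ[(κL.layer (0 + 1))] (κL.layer (0 + (1 + 1))))))
    :
    haveI := isElliptic_315832c1
    ∀ (κ : ZpExtension ℚ 2), κ.IsCyclotomic →
      ∃ (γ : Field.absoluteGaloisGroup ℚ) (D : (⟨0, 0, 0, 79574117, 176712113750⟩ : WeierstrassCurve ℚ).FineSelmerDualData κ γ),
        Module.Finite ℤ_[2] (RestrictScalars ℤ_[2] (IwasawaAlgebra 2) D.X) :=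
  conjA_two_of_eq_g14 (W' := (⟨0, ((0 : ℤ) : ℚ), 0, ((79574117 : ℤ) : ℚ), ((176712113750 : ℤ) : ℚ)⟩ : WeierstrassCurve ℚ)) (by norm_num)
    (fun κ hκ ↦ AddKatoTwo.conjA_two_315832c1_of_layerOneNonNormUnit hθ hunit κ hκ)

/-- **`BSD₂(315832c1)` with (A) from ONE displayed sextic statement and NO print fact for (A)**: GEN 3's rung `bsdp_two_315832c1_of_conjA` with `hA`
supplied by `conjA_two_315832c1_of_layerOneNonNormUnit_kernelLit hθ hunit`. Conditional on PRINT {`hSharp` (reading), `hGZK`, `hmod`, `hCT`}, the RECORD `hr`, `#Ш_an = q`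
(`ord₂ q ≤ 6`), the two VALUED slots and ONE sextic statement `hunit`. Nothing booked; BSD is not proved by this.
[cite: Kato2004Asterisque, Thm. 12.5 (1)(3), 13.8, 14.14] [cite: Washington1997, §13.3 Prop. 13.23] [cite: Miller2011LMS, Def. 1.1] -/
theorem bsdp_two_315832c1_layerOneNonNormUnit
    (hSharp : Kato2004.rankZero_padicValNat_sha_add_padicValNat_tamagawa_le_at_two_of_irreducible_of_fineSelmerDual_fg)
    (hGZK : rank_eq_analyticRank_of_analyticRank_le_one) (hmod : hasEntireLFunction_rat)
    (hCT : exists_casselsTate_pairing (K := ℚ))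
    {θ : AlgebraicClosure ℚ} (hθ : aeval θ (Cubic.toPoly ⟨1, ((-1 : ℤ) : ℚ), ((-24 : ℤ) : ℚ), ((88 : ℤ) : ℚ)⟩) = 0)
    (hunit : haveI : FiniteDimensional ℚ (IntermediateField.adjoin ℚ {θ}) :=
        IntermediateField.adjoin.finiteDimensional ((AlgebraicClosure.isAlgebraic ℚ).isAlgebraic θ).isIntegral
      haveI : NumberField (IntermediateField.adjoin ℚ {θ}) := NumberField.mk
      ∀ κL : ZpExtension (IntermediateField.adjoin ℚ {θ}) 2, κL.IsCyclotomic →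
        haveI : FiniteDimensional (IntermediateField.adjoin ℚ {θ}) (κL.layer (0 + 1)) := κL.finiteDimensional_layer_holds _
        haveI : FiniteDimensional (IntermediateField.adjoin ℚ {θ}) (κL.layer (0 + (1 + 1))) := κL.finiteDimensional_layer_holds _
        haveI : NumberField (κL.layer (0 + 1)) := NumberField.of_module_finite (IntermediateField.adjoin ℚ {θ}) (κL.layer (0 + 1))
        haveI : NumberField (κL.layer (0 + (1 + 1))) := NumberField.of_module_finite (IntermediateField.adjoin ℚ {θ}) (κL.layer (0 + (1 + 1)))
        letI : Algebra (κL.layer (0 + 1)) (κL.layer (0 + (1 + 1))) := (IntermediateField.inclusion (κL.layer_mono (by omega))).toRingHom.toAlgebra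
        ∃ u : ((κL.layer (0 + (1 + 1))))ˣ, u ∈ unitsE (κL.layer (0 + (1 + 1))) ⊓ (unitsIncl (κL.layer (0 + 1)) (κL.layer (0 + (1 + 1)))).range ∧
          u ∉ unitsE (κL.layer (0 + (1 + 1))) ⊓ (⊤ : Subgroup ((κL.layer (0 + (1 + 1))))ˣ).map (Herbrand.norm ((κL.layer (0 + (1 + 1))) ≃ₐ[(κL.layer (0 + 1))] (κL.layer (0 + (1 + 1))))))
    (hr : haveI := isElliptic_315832c1; (⟨0, 0, 0, 79574117, 176712113750⟩ : WeierstrassCurve ℚ).analyticRank = 0)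
    (hs₁ : Nat.card ((⟨0, 0, 0, 79574117, 176712113750⟩ : WeierstrassCurve ℚ).selmerGroup (2 ^ 2)) = 2 ^ 4)
    (hs₂ : Nat.card ((⟨0, 0, 0, 79574117, 176712113750⟩ : WeierstrassCurve ℚ).selmerGroup (2 ^ (2 + 1))) = 2 ^ 6)
    {q : ℚ} (hq : haveI := isElliptic_315832c1; shaAn (⟨0, 0, 0, 79574117, 176712113750⟩ : WeierstrassCurve ℚ) = (q : ℂ)) (hv : padicValRat 2 q ≤ 6) :
    haveI := isElliptic_315832c1; haveI := isGloballyMinimal_315832c1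
    BSDp (⟨0, 0, 0, 79574117, 176712113750⟩ : WeierstrassCurve ℚ) 2 := by
  exact bsdp_two_315832c1_of_conjA hSharp hGZK hmod hCT (conjA_two_315832c1_of_layerOneNonNormUnit_kernelLit hθ hunit) hr hs₁ hs₂ hq hv

/-- **`BSD₂` ON THE WHOLE CLASS of `315832c1` with (A) from ONE displayed sextic statement and NO print fact for (A)**: GEN 3's class rung
`bsdp_two_of_isIsogenous_315832c1_of_conjA` (Cassels transport `hCassels`) with `hA` from `conjA_two_315832c1_of_layerOneNonNormUnit_kernelLit hθ hunit`.
Nothing booked; BSD is not proved by this. [cite: Cassels1965ArithmeticVIII, Thm. 1.3] [cite: Kato2004Asterisque, Thm. 12.5 (1)(3)] [cite: Washington1997, §13.3 Prop. 13.23] -/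
theorem bsdp_two_of_isIsogenous_315832c1_layerOneNonNormUnit
    (hSharp : Kato2004.rankZero_padicValNat_sha_add_padicValNat_tamagawa_le_at_two_of_irreducible_of_fineSelmerDual_fg)
    (hGZK : rank_eq_analyticRank_of_analyticRank_le_one) (hmod : hasEntireLFunction_rat)
    (hCT : exists_casselsTate_pairing (K := ℚ)) (hCassels : bsdRHS_eq_of_isIsogenous)
    {θ : AlgebraicClosure ℚ} (hθ : aeval θ (Cubic.toPoly ⟨1, ((-1 : ℤ) : ℚ), ((-24 : ℤ) : ℚ), ((88 : ℤ) : ℚ)⟩) = 0)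
    (hunit : haveI : FiniteDimensional ℚ (IntermediateField.adjoin ℚ {θ}) :=
        IntermediateField.adjoin.finiteDimensional ((AlgebraicClosure.isAlgebraic ℚ).isAlgebraic θ).isIntegral
      haveI : NumberField (IntermediateField.adjoin ℚ {θ}) := NumberField.mk
      ∀ κL : ZpExtension (IntermediateField.adjoin ℚ {θ}) 2, κL.IsCyclotomic →
        haveI : FiniteDimensional (IntermediateField.adjoin ℚ {θ}) (κL.layer (0 + 1)) := κL.finiteDimensional_layer_holds _
        haveI : FiniteDimensional (IntermediateField.adjoin ℚ {θ}) (κL.layer (0 + (1 + 1))) := κL.finiteDimensional_layer_holds _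
        haveI : NumberField (κL.layer (0 + 1)) := NumberField.of_module_finite (IntermediateField.adjoin ℚ {θ}) (κL.layer (0 + 1))
        haveI : NumberField (κL.layer (0 + (1 + 1))) := NumberField.of_module_finite (IntermediateField.adjoin ℚ {θ}) (κL.layer (0 + (1 + 1)))
        letI : Algebra (κL.layer (0 + 1)) (κL.layer (0 + (1 + 1))) := (IntermediateField.inclusion (κL.layer_mono (by omega))).toRingHom.toAlgebra
        ∃ u : ((κL.layer (0 + (1 + 1))))ˣ, u ∈ unitsE (κL.layer (0 + (1 + 1))) ⊓ (unitsIncl (κL.layer (0 + 1)) (κL.layer (0 + (1 + 1)))).range ∧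
          u ∉ unitsE (κL.layer (0 + (1 + 1))) ⊓ (⊤ : Subgroup ((κL.layer (0 + (1 + 1))))ˣ).map (Herbrand.norm ((κL.layer (0 + (1 + 1))) ≃ₐ[(κL.layer (0 + 1))] (κL.layer (0 + (1 + 1))))))
    {W : WeierstrassCurve ℚ} [W.IsElliptic] [W.IsGloballyMinimal]
    (hiso : haveI := isElliptic_315832c1; IsIsogenous W (⟨0, 0, 0, 79574117, 176712113750⟩ : WeierstrassCurve ℚ)) (hr : W.analyticRank = 0)
    (hs₁ : Nat.card ((⟨0, 0, 0, 79574117, 176712113750⟩ : WeierstrassCurve ℚ).selmerGroup (2 ^ 2)) = 2 ^ 4)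
    (hs₂ : Nat.card ((⟨0, 0, 0, 79574117, 176712113750⟩ : WeierstrassCurve ℚ).selmerGroup (2 ^ (2 + 1))) = 2 ^ 6)
    {q : ℚ} (hq : haveI := isElliptic_315832c1; shaAn (⟨0, 0, 0, 79574117, 176712113750⟩ : WeierstrassCurve ℚ) = (q : ℂ)) (hv : padicValRat 2 q ≤ 6) :
    BSDp W 2 := by
  exact bsdp_two_of_isIsogenous_315832c1_of_conjA hSharp hGZK hmod hCT hCassels (conjA_two_315832c1_of_layerOneNonNormUnit_kernelLit hθ hunit) hiso hr hs₁ hs₂ hq hv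

end Summit.BirchSwinnertonDyer.BirchSwinnertonDyer.Theorems.AddPotGoodInstances

end
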